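import Literature.AnabelianGeometry.AbsoluteAnabelian.ArchimedeanReconstructionCor28Sub
import HarnessLib

/-!
# [AbsTopIII] Cor 2.8 (a)/(b): the records `NFCurveData.AnalyticComparison` and `NFCurveData.Chart`
# are inhabited over every `NFCurveData` — §4(iii) NON-VACUITY, DEGENERATE-honest (abc-iut-w5-d197, gen 2)

S. Mochizuki, *Topics in absolute anabelian geometry III* (2015) [AbsTopIII], Cor 2.8 (a) p. 63 (the
comparison `X^top = X_v(k_v)`) and Cor 2.8 (b) pp. 63–64 (the charts `f_U : U_X ⥲ U_v`), typed by
abc-iut-L4-t14 / abc-iut-w5-d140 as the interface records `NFCurveData.AnalyticComparison D`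
(`ArchimedeanReconstructionCor28Sub.lean`) and `NFCurveData.Chart D U_X` (`ArchimedeanReconstruction.lean`).
Both rows read ZERO producers in the L4 inhabitation census v2 (05:58Z).  This PROOF-ONLY file (no
`def`/`instance`/`structure`) records, over EVERY `D : NFCurveData`:

* `AnalyticComparison.nonempty_tautological` — the TAUTOLOGICAL comparison datum `X^an := D.Pt` (the
  NF-points themselves, discrete topology, `pt := id`, `fval f x := (D.eval f x).map D.emb`): the
  record's one law `fval_pt` holds by `rfl`.  Label «tautological»: it is NOT the analytic space
  `X_v(k_v)`; of the four Cor 2.8 (a) r8 clauses it makes `DensePoints` trivially true and says nothing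
  honest about the others — the record is a data slot, and this shows only that the slot is consistent.
* `Chart.nonempty_bot` — the EMPTY chart on the empty open `U_X = ∅` (`U_v = ∅`, `f_U` the empty
  homeomorphism, `f` any NF-rational function; the limit clause is vacuous).  Label «vacuous»: genuine
  charts need the analytic comparison of a real curve (abc-iut-w5-d140's `AutHolWitness.D₂` is the
  only concrete `NFCurveData`; no genuine chart of it is constructed here).  Requires `D.Fn` inhabited.
* `Chart.isEmpty_of_isEmpty_fn` — conversely, with NO NF-rational function there is no chart at all.

No side taken on [IUTchIII] Cor 3.12; a witness is consistency evidence, not an endorsement; typed ≠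
proved; tautological ≠ analytic.
-/

namespace Literature.AnabelianGeometry.AbsoluteAnabelian.ArchimedeanReconstruction

open _root_.Filter _root_.Topology _root_.Set _root_.TopologicalSpace

variable (D : NFCurveData)

/-- **[AbsTopIII] Cor 2.8 (a) r8 — the comparison record is inhabited (TAUTOLOGICAL datum).**  Over
every `D`: `X^an := D.Pt` (discrete), `pt := id`, `fval f x := (D.eval f x).map D.emb`.  Label
«tautological» (not `X_v(k_v)`). [cite: MochizukiAbsTopIII2015, Corollary 2.8 (a) p.63] -/
theorem NFCurveData.AnalyticComparison.nonempty_tautological :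
    ∃ C : D.AnalyticComparison, C.Xan = D.Pt ∧ C.DensePoints :=
  ⟨{ Xan := D.Pt
     top := ⊥
     pt := id
     fval := fun f x => (D.eval f x).map D.emb
     fval_pt := fun _ _ => rfl }, rfl, by
    letI : TopologicalSpace D.Pt := ⊥
    change DenseRange (id : D.Pt → D.Pt)
    exact denseRange_id⟩

/-- Hence `Nonempty D.AnalyticComparison` for every `D`. [cite: MochizukiAbsTopIII2015, Corollary 2.8 (a) p.63] -/
theorem NFCurveData.AnalyticComparison.nonempty : Nonempty D.AnalyticComparison := by
  obtain ⟨C, -, -⟩ := NFCurveData.AnalyticComparison.nonempty_tautological D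
  exact ⟨C⟩

/-- **[AbsTopIII] Cor 2.8 (b) — the chart record is inhabited on the EMPTY open** (VACUOUS datum):
`U_X = ∅`, `U_v = ∅`, `f_U` the empty homeomorphism, `f` any NF-rational function (so `D.Fn` must be
inhabited). Label «vacuous». [cite: MochizukiAbsTopIII2015, Corollary 2.8 (b) p.63] -/
theorem NFCurveData.Chart.nonempty_bot (f : D.Fn) : Nonempty (D.Chart ⊥) := by
  haveI h₁ : IsEmpty ((⊥ : Opens D.Xtop) : Type) :=
    ⟨fun x => by
      have h : (x.1 : D.Xtop) ∈ ((⊥ : Opens D.Xtop) : Set D.Xtop) := x.2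
      rw [Opens.coe_bot] at h
      exact (Set.mem_empty_iff_false _).mp h⟩
  haveI h₂ : IsEmpty ((⊥ : Opens D.kv) : Type) :=
    ⟨fun x => by
      have h : (x.1 : D.kv) ∈ ((⊥ : Opens D.kv) : Set D.kv) := x.2
      rw [Opens.coe_bot] at h
      exact (Set.mem_empty_iff_false _).mp h⟩
  exact ⟨{ Uv := ⊥
           f := f
           fU := Homeomorph.empty
           fU_spec := fun x hx => (h₁.false ⟨_, hx⟩).elim }⟩

/-- Conversely a chart carries an NF-rational function, so with `D.Fn` empty there is no chart on any
open. [cite: MochizukiAbsTopIII2015, Corollary 2.8 (b) p.63] -/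
theorem NFCurveData.Chart.isEmpty_of_isEmpty_fn [IsEmpty D.Fn] (UX : Opens D.Xtop) :
    IsEmpty (D.Chart UX) :=
  ⟨fun c => isEmptyElim c.f⟩

/-- The exact criterion on the empty open: `Chart ∅` is inhabited iff `D.Fn` is.
[cite: MochizukiAbsTopIII2015, Corollary 2.8 (b) p.63] -/
theorem NFCurveData.Chart.nonempty_bot_iff : Nonempty (D.Chart ⊥) ↔ Nonempty D.Fn :=
  ⟨fun ⟨c⟩ => ⟨c.f⟩, fun ⟨f⟩ => NFCurveData.Chart.nonempty_bot D f⟩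

end Literature.AnabelianGeometry.AbsoluteAnabelian.ArchimedeanReconstruction
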